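import Literature.AlgebraicGeometry.Resolution.HironakaGroupSchemeAdditiveGenerators
import Literature.RingTheory.MvPolynomial.Directrix
import HarnessLib

/-!
# Hironaka's `U(𝔭)` in characteristic zero: generated by LINEAR forms; `B_{P,𝔭}` is a vector group;
# the directrix of an ideal generated inside `U(𝔭)` lies in `𝔭` (Hironaka 1970 Th. 1 / Dietel 2015 (3.3.8) (i), (9.1.3))

Topic: `Literature/AlgebraicGeometry/Resolution`, sub-namespace `HironakaScheme`. Sequel of
`HironakaGroupSchemeAdditiveGenerators.lean` (positive characteristic: `U(𝔭)` is generated by additive forms,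
`Hironaka1970_thm1_cor_holds`). Over a field `k` of CHARACTERISTIC ZERO the same route — `U(𝔭)` is a graded
Hasse–Schmidt-stable subalgebra of `k[X]` (`isGradedSubalgebra_multAlgebra`, `isDiffStable_multAlgebra`), hence
(structure theorem `exists_eq_adjoin_triangular_of_isDiffStable_fin` at exponential characteristic `p = 1`) a
polynomial algebra on LINEAR forms — gives:

* `exists_multAlgebra_eq_adjoin_linearForms` — `U(𝔭) = k[ℓ_1, …, ℓ_r]` with `ℓ_j ∈ S_1` linear forms lying in
  `U(𝔭)` («In characteristic zero `U_x` will be generated by polynomials of degree one», Dietel 2015 Def. (9.1.3)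
  p. 108; Hironaka 1970 (Kyoto) (13.2) «If `p = 0`, then `q_i = 1` for all `i`»);
* `isVectorGroup_of_charZero` — `B_{P,𝔭} = Spec(S/U_+S)` is a vector group: `U_+(𝔭)S` is generated by its linear
  forms (Dietel 2015 (3.3.8) (i) «If `ℚ ⊆ A`, then `B ≅ Sym_A(B_1)`»: all groups are vector spaces in characteristic
  zero);
* **`directrixSpace_le_prime_of_charZero`** — if an ideal `I ⊆ k[X]` is generated by elements of `U(𝔭)` (the
  conclusion shape of [H4] Th. IV: «the ideal of `C_{X,x}` is generated by elements of `U_{g,x'}`»), then every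
  linear form of its directrix space `𝒯(I)` (CJS Lemma 2.7) lies in `𝔭`: `𝒯(I) ⊆ span(ℓ_j) ⊆ U_+(𝔭)S ⊆ 𝔭`. This is
  the characteristic-zero branch of CJS Thm. 3.14 («`B_{P,x'}` is a vector subspace of `V` if `char(k(x)) = 0`»,
  p. 52), with NO dimension hypothesis.

Everything is PROVED; no named facts. Written for the cell res-hironaka (HIRONAKA-L librarian seat res-D-lib-1;
consumer: the `char k(x) = 0` branch of CJS Thm. 3.14 from [H4] Th. IV). AI-written; AI review is weaker than
expert review.

## References

* H. Hironaka, J. Math. Kyoto Univ. 10 (1970), (13.2) p. 168 L32–38. [Hironaka1970NumericalCharacters]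
* B. Dietel, Dissertation Regensburg (2015), Prop. (3.3.8) (i) p. 41, Def. (9.1.3)–Lemma (9.1.4) p. 108. [Dietel2015]
* V. Cossart, U. Jannsen, S. Saito, LNM 2270 (2020), Lemma 2.7, Thm. 3.14 (proof, p. 52). [CossartJannsenSaito2020]
-/

noncomputable section

open MvPolynomial
open Literature.RingTheory.MvPolynomial

namespace Literature.AlgebraicGeometry.Resolution.HironakaScheme

universe u

variable {k : Type u} [Field k] [CharZero k] {m : ℕ}

/-- **In characteristic zero `U(𝔭)` is generated by linear forms**: `U(𝔭) = k[ℓ_1, …, ℓ_r]` for linear forms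
`ℓ_j = Σ_l c_{jl} X_l` (which then lie in `U(𝔭)`), for every prime `𝔭 ⊆ k[X_1, …, X_m]`.
[cite: Dietel2015, Def. (9.1.3) p. 108 («in characteristic zero U_x will be generated by polynomials of degree one»)]
[cite: Hironaka1970NumericalCharacters, (13.2) p. 168 L36–38] -/
theorem exists_multAlgebra_eq_adjoin_linearForms (𝔭 : Ideal (MvPolynomial (Fin m) k)) [𝔭.IsPrime] :
    ∃ (r : ℕ) (c : Fin r → Fin m → k),
      multAlgebra k 𝔭 = Algebra.adjoin k (Set.range fun j => (∑ l, C (c j l) * X l : MvPolynomial (Fin m) k)) := by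
  classical
  haveI : ExpChar k 1 := ExpChar.zero
  obtain ⟨r, _, e, c, -, -, -, -, -, -, hU⟩ :=
    exists_eq_adjoin_triangular_of_isDiffStable_fin 1 (multAlgebra k 𝔭)
      (isGradedSubalgebra_multAlgebra 𝔭) (isDiffStable_multAlgebra 𝔭)
  refine ⟨r, c, ?_⟩
  rw [hU]
  congr 2
  funext j
  simp only [one_pow, pow_one]

omit [CharZero k] in
/-- A linear form `Σ_l c_l X_l` is homogeneous of degree `1`. [folklore] -/
private theorem isHomogeneous_one_linearForm (c : Fin m → k) :
    (∑ l, C (c l) * X l : MvPolynomial (Fin m) k).IsHomogeneous 1 :=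
  IsHomogeneous.sum _ _ _ fun l _ => (isHomogeneous_X k l).C_mul (c l)

omit [CharZero k] in
/-- A linear form `Σ_l c_l X_l` has no constant term. [folklore] -/
private theorem constantCoeff_linearForm (c : Fin m → k) :
    constantCoeff (∑ l, C (c l) * X l : MvPolynomial (Fin m) k) = 0 := by
  rw [map_sum]
  exact Finset.sum_eq_zero fun l _ => by rw [map_mul, constantCoeff_X, mul_zero]

/-- **In characteristic zero every Hironaka scheme `B_{P,𝔭}` is a vector group**: the ideal `U_+(𝔭)S` is generated
by the linear forms it contains. [cite: Dietel2015, Prop. (3.3.8) (i) p. 41] -/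
theorem isVectorGroup_of_charZero (𝔭 : Ideal (MvPolynomial (Fin m) k)) [𝔭.IsPrime] : IsVectorGroup k 𝔭 := by
  classical
  obtain ⟨r, c, hU⟩ := exists_multAlgebra_eq_adjoin_linearForms 𝔭
  set ℓ : Fin r → MvPolynomial (Fin m) k := fun j => ∑ l, C (c j l) * X l with hℓ
  unfold IsVectorGroup
  refine le_antisymm ?_ (span_inter_one_le 𝔭)
  -- every `ℓ_j` is a linear form of `U_+(𝔭)S`
  have hℓmem : ∀ j, ℓ j ∈ ((bIdeal k 𝔭 : Set (MvPolynomial (Fin m) k)) ∩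
      (homogeneousSubmodule (Fin m) k 1 : Set (MvPolynomial (Fin m) k))) := fun j =>
    ⟨Ideal.subset_span ⟨by rw [SetLike.mem_coe, hU]; exact Algebra.subset_adjoin ⟨j, rfl⟩,
        constantCoeff_linearForm (c j)⟩,
      (mem_homogeneousSubmodule 1 _).mpr (isHomogeneous_one_linearForm (c j))⟩
  -- generators of `U_+(𝔭)S` lie in `(ℓ_1, …, ℓ_r)`
  refine Ideal.span_le.mpr ?_
  rintro u ⟨hu, hu0⟩
  have hu' : u ∈ Algebra.adjoin k (Set.range ℓ) := by rw [← hU]; exact hu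
  have hG0 : ∀ g ∈ Set.range ℓ, constantCoeff g = 0 := by
    rintro _ ⟨j, rfl⟩; exact constantCoeff_linearForm (c j)
  have h := sub_C_constantCoeff_mem_ideal_span_of_mem_adjoin hG0 hu'
  rw [show constantCoeff u = 0 from hu0, C_0, sub_zero] at h
  refine Ideal.span_mono ?_ h
  rintro _ ⟨j, rfl⟩
  exact hℓmem j

/-- **The characteristic-zero branch of CJS Thm. 3.14 / [H4] Th. IV ⇒ near points lie on the directrix**: if an
ideal `I ⊆ k[X_1, …, X_m]` (`char k = 0`) is generated by its elements lying in `U(𝔭)` for a prime `𝔭`, then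
every linear form of the directrix space `𝒯(I)` lies in `𝔭` — `U(𝔭) = k[ℓ]` with `ℓ_j` linear, so `span(ℓ)`
directs `I` (CJS Lemma 2.7) and `𝒯(I) ⊆ span(ℓ_j) ⊆ U_+(𝔭)S ⊆ 𝔭`. No dimension hypothesis is needed.
[cite: CossartJannsenSaito2020, Thm. 3.14 (proof p. 52, «a vector subspace of V if char(k(x)) = 0») and Lemma 2.7]
[cite: Dietel2015, Def. (9.1.3) p. 108] -/
theorem directrixSpace_le_prime_of_charZero {𝔭 : Ideal (MvPolynomial (Fin m) k)} [𝔭.IsPrime]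
    {I : Ideal (MvPolynomial (Fin m) k)}
    (hI : I ≤ Ideal.span ((I : Set (MvPolynomial (Fin m) k)) ∩ (multAlgebra k 𝔭 : Set (MvPolynomial (Fin m) k))))
    {f : MvPolynomial (Fin m) k} (hf : f ∈ directrixSpace I) : f ∈ 𝔭 := by
  classical
  obtain ⟨r, c, hU⟩ := exists_multAlgebra_eq_adjoin_linearForms 𝔭
  set ℓ : Fin r → MvPolynomial (Fin m) k := fun j => ∑ l, C (c j l) * X l with hℓ
  set T : Submodule k (MvPolynomial (Fin m) k) := Submodule.span k (Set.range ℓ) with hT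
  -- `span(ℓ)` directs `I`
  have hT1 : T ≤ homogeneousSubmodule (Fin m) k 1 :=
    Submodule.span_le.mpr (by rintro _ ⟨j, rfl⟩; exact (mem_homogeneousSubmodule 1 _).mpr (isHomogeneous_one_linearForm (c j)))
  have hadj : Algebra.adjoin k (T : Set (MvPolynomial (Fin m) k)) = multAlgebra k 𝔭 := by
    rw [hU, hT, Algebra.adjoin_span]
  have hdir : Directs I T := by
    refine directs_iff.mpr ⟨hT1, ?_⟩
    rw [hadj]; exact hI
  -- so `𝒯(I) ⊆ span(ℓ) ⊆ 𝔭`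
  have hfT : f ∈ T := directrixSpace_le hdir hf
  have hTp : T ≤ (𝔭.restrictScalars k) := by
    refine Submodule.span_le.mpr ?_
    rintro _ ⟨j, rfl⟩
    refine mem_of_mem_multAlgebra_of_constantCoeff_eq_zero ?_ (constantCoeff_linearForm (c j))
    rw [hU]; exact Algebra.subset_adjoin ⟨j, rfl⟩
  exact hTp hfT

end Literature.AlgebraicGeometry.Resolution.HironakaScheme

end
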